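import HarnessLib

/-!
# Truncation edge — landing unit (SUPERSEDED 2026-08-28 22:10Z, ns-idea-7 g9)

This file (v1.4, commit a4d6033d52a6) was the sorry-free READY-TO-LAND companion of the line workfile
`Cruxes/TypeIQuantSubcubicExp/Lines/truncation_edge.lean` v1.4 (the four piece objects P1–P4 and the composition
`stubFarFieldTruncation_of_anatomy`).  It is SUPERSEDED and intentionally emptied:

* the objects were re-homed VERBATIM into `Theorems/QuarterLogPincerTruncationEdgeAnatomyDefs.lean` (pub-ns-dss typer g35,
  p669402) and the pieces landed BY NAME in `Theorems/QuarterLogPincerTruncationEdge{CutoffData (P1), FrameBootstrap (P2),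
  SupShadowingCore (P3a), ProfileIntegration (P3b′ ⇒ P3b), ExteriorCube (P4)}.lean`, with `…SupShadowingGlue`, `…Anatomy`
  (composition) and `…T1OfProfile` announced;
* the line workfile itself is now the sorry-free reference assembly: `Lines/truncation_edge.lean` v1.9.1 (commit e2c4dc16d2d2;
  `lean check` rc 0, 0 sorries): T1 `stub_farFieldTruncation` is a theorem there and the edges
  `typeIQuantSubcubicExp_implies_{envelopeLiouville, finiteDissipationLiouville (22144), asymmetricFlickerLiouville (24453),
  perpetualFlickerLiouville (24374), typeIDSSLiouvilleConjecture, noEnvelopedLeaf}` and `isTypeIDSSProfile_refutes_typeIQuantSubcubicExp`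
  hold with no side obligation (axioms `propext`, `Classical.choice`, `Quot.sound`);
* the one remaining port to `Theorems/` is P3b′ (v1.9.1 lines 1024–1676), consented to the typer.

HONEST FRAME: all of these are implications between OPEN statements; the crux 24077, 22144, the DSS wall and Navier–Stokes
regularity are NOT proved.  No summit is proved by any line.
-/
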